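import Mathlib
import Summits.AtomisticToContinuum.HydrodynamicLimit.Theorems.InformationPercolationEngineKickFairRelEquilibriumMesoDefs
import Summits.AtomisticToContinuum.HydrodynamicLimit.Theorems.InformationPercolationEngineKickFairRelEquilibriumMesoTransferEnum
import HarnessLib

/-!
# `KickFairRelEquilibriumMeso`, line `Sketch` — glue T, part (c1): the crux's kick sum is the sum of
# its windowed pieces, pointwise

Helper file (`--supports stmt-AtomisticToContinuum-15177`) of the line lead for the registered glue stub
`stub_pinchTransfer`. With `w k = k τ / m` (`k = 0, …, m`) the windows `(w k, w (k+1)]` tile `(0, τ]`; by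
T-a (`transferEnum`: for `n < cnt` the `n`-th enumerated collision time of a sphere lies in `(0, τ]`,
for EVERY initial datum) each kick counted by the crux falls in exactly one window, so the crux's
compensated kick sum `fullSum` equals `Σ_{k < m} slotSum … (w k) (w (k+1)) …` everywhere (no good set,
no null set).

* `sum_window_indicator_eq_one` — for `t ∈ (0, τ]`, `m ≥ 1`: `Σ_{k<m} 𝟙{w k < t ≤ w (k+1)} = 1`;
* `fullSum` — the crux's `S` over the landed vocabulary (`past`, `kick`, `kappa`, `cnt`);
* `fullSum_eq_sum_slotSum` — `fullSum = Σ_{k<m} slotSum (w k) (w (k+1))` pointwise;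
* `transferSlots` — the registered sub-goal (the last identity with all binders after the colon).
-/

noncomputable section

open MeasureTheory Set Filter Topology
open scoped ENNReal Classical

namespace Summit.AtomisticToContinuum.HydrodynamicLimit.Theorems.KickFairRelEquilibriumMesoLine

open Literature.Analysis.FluidPDE Literature.MathematicalPhysics.KineticTheory

/-! ## Windows tiling `(0, τ]` -/

/-- The window ends `w k = k τ / m`. [folklore] -/
def wEnd (τ : ℝ) (m k : ℕ) : ℝ := (k : ℝ) * τ / (m : ℝ)

/-- `w 0 = 0`. [folklore] -/
@[simp] theorem wEnd_zero (τ : ℝ) (m : ℕ) : wEnd τ m 0 = 0 := by simp [wEnd]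

/-- `w m = τ` for `m ≥ 1`. [folklore] -/
theorem wEnd_self {τ : ℝ} {m : ℕ} (hm : 0 < m) : wEnd τ m m = τ := by
  have : (m : ℝ) ≠ 0 := by exact_mod_cast hm.ne'
  simp [wEnd, this]

/-- **Each point of `(0, τ]` lies in exactly one window**: for `t ∈ (0, τ]` and `m ≥ 1` the window
indicators sum to one. [folklore] -/
theorem sum_window_indicator_eq_one {τ : ℝ} (hτ : 0 < τ) {m : ℕ} (hm : 0 < m) {t : ℝ} (ht : t ∈ Ioc 0 τ) :
    ∑ k ∈ Finset.range m, (if wEnd τ m k < t ∧ t ≤ wEnd τ m (k + 1) then (1 : ℝ) else 0) = 1 := by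
  have hmR : (0 : ℝ) < m := by exact_mod_cast hm
  -- the index of the window containing `t`
  set u : ℝ := t * m / τ with hu
  have hu0 : 0 < u := by rw [hu]; exact div_pos (mul_pos ht.1 hmR) hτ
  have hum : u ≤ m := by
    rw [hu, div_le_iff₀ hτ]
    nlinarith [ht.2]
  set k₀ : ℕ := ⌈u⌉₊ - 1 with hk₀
  have hceil1 : 1 ≤ ⌈u⌉₊ := Nat.one_le_iff_ne_zero.2 (by
    intro h0; have := Nat.ceil_eq_zero.1 h0; linarith)
  have hceilm : ⌈u⌉₊ ≤ m := Nat.ceil_le.2 (by exact_mod_cast hum)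
  have hk₀m : k₀ < m := by omega
  -- the condition `w k < t ≤ w (k+1)` is equivalent to `k = k₀`
  have hiff : ∀ k : ℕ, (wEnd τ m k < t ∧ t ≤ wEnd τ m (k + 1)) ↔ k = k₀ := by
    intro k
    have h1 : wEnd τ m k < t ↔ (k : ℝ) < u := by
      rw [wEnd, hu, div_lt_iff₀ hmR, lt_div_iff₀ hτ]
    have h2 : t ≤ wEnd τ m (k + 1) ↔ u ≤ (k : ℝ) + 1 := by
      rw [wEnd, hu, div_le_iff₀ hτ, le_div_iff₀ hmR]
      push_cast
      constructor <;> intro h <;> nlinarith [h]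
    rw [h1, h2]
    constructor
    · rintro ⟨hk, hk'⟩
      have hc : ⌈u⌉₊ = k + 1 := by
        refine le_antisymm (Nat.ceil_le.2 (by exact_mod_cast hk')) ?_
        have : (k : ℝ) < ⌈u⌉₊ := hk.trans_le (Nat.le_ceil u)
        exact_mod_cast this
      omega
    · rintro rfl
      have hcast : ((⌈u⌉₊ - 1 : ℕ) : ℝ) = (⌈u⌉₊ : ℝ) - 1 := by
        rw [Nat.cast_sub hceil1]; push_cast; ring
      refine ⟨?_, ?_⟩
      · rw [hcast]
        have := Nat.ceil_lt_add_one hu0.le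
        linarith
      · rw [hcast]
        have := Nat.le_ceil u
        linarith
  rw [Finset.sum_ite, Finset.sum_const_zero, add_zero, Finset.sum_const, nsmul_eq_mul, mul_one]
  have : (Finset.range m).filter (fun k => wEnd τ m k < t ∧ t ≤ wEnd τ m (k + 1)) = {k₀} := by
    ext k
    simp only [Finset.mem_filter, Finset.mem_range, Finset.mem_singleton, hiff]
    constructor
    · exact fun h => h.2
    · rintro rfl; exact ⟨hk₀m, rfl⟩
  rw [this]; simp

/-! ## The crux's kick sum over the vocabulary, and its slot decomposition -/

/-- The crux's compensated kick sum `S` (its `let`-chain verbatim over the landed vocabulary):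
`(ε/(N+1)) Σ_i Σ_{n < cnt_i} h_{i,n}(P_{i,n}) (g(X_{i,n}) − κ_{i,n})`. [folklore] -/
def fullSum {σ : ℝ} {N : ℕ} (Φ : Flow σ N) (τ r : ℝ) (g : V3 × V3 × V3 → ℝ)
    (h : Fin (N + 1) → ℕ → Past N → ℝ) (z : Phase N) : ℝ :=
  hsDiameter σ N / ((N : ℝ) + 1) * ∑ i : Fin (N + 1), ∑ n ∈ Finset.range (cnt Φ τ z i),
    h i n (past Φ r z i n) * (g (kick Φ i n z) - kappa Φ r g i n z)

/-- **For `n < cnt` the `n`-th collision time of `i` along the orbit of `z` lies in `(0, τ]`**, for EVERY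
initial datum (T-a, `nthTimeAfter_mem_of_lt_ncard`). [folklore] -/
theorem nthCollisionTimeOf_mem_Ioc_of_lt_cnt {σ : ℝ} {N : ℕ} (Φ : Flow σ N) (τ : ℝ) (z : Phase N)
    (i : Fin (N + 1)) {n : ℕ} (hn : n < cnt Φ τ z i) : Φ.nthCollisionTimeOf i n z ∈ Ioc 0 τ :=
  (nthTimeAfter_mem_of_lt_ncard (S := collisionTimesOf (Torus.geometry (Fin 3)) (hsDiameter σ N)
    (fun s => Φ.flow s z) i) (a := 0) (b := τ) hn).2

/-- **The crux's kick sum is the sum of its windowed pieces, pointwise**: for `m ≥ 1` windows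
`(w k, w (k+1)]`, `w k = kτ/m`, `fullSum = Σ_{k<m} slotSum (w k) (w (k+1))`. [folklore] -/
theorem fullSum_eq_sum_slotSum {σ : ℝ} {N : ℕ} (Φ : Flow σ N) {τ : ℝ} (hτ : 0 < τ) (r : ℝ)
    (g : V3 × V3 × V3 → ℝ) (h : Fin (N + 1) → ℕ → Past N → ℝ) {m : ℕ} (hm : 0 < m) (z : Phase N) :
    fullSum Φ τ r g h z = ∑ k ∈ Finset.range m, slotSum Φ τ r (wEnd τ m k) (wEnd τ m (k + 1)) g h z := by
  unfold fullSum slotSum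
  rw [← Finset.mul_sum]
  congr 1
  rw [Finset.sum_comm]
  refine Finset.sum_congr rfl fun i _ => ?_
  rw [Finset.sum_comm]
  refine Finset.sum_congr rfl fun n hn => ?_
  rw [← Finset.sum_mul, sum_window_indicator_eq_one hτ hm
    (nthCollisionTimeOf_mem_Ioc_of_lt_cnt Φ τ z i (Finset.mem_range.1 hn)), one_mul]

/-- **Registered sub-goal `transferSlots` of the glue (T-c1)**: the slot decomposition with all binders after
the colon. [folklore] -/
theorem transferSlots : ∀ (σ : ℝ) (N : ℕ) (Φ : Flow σ N) (τ : ℝ), 0 < τ → ∀ (r : ℝ) (g : V3 × V3 × V3 → ℝ)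
    (h : Fin (N + 1) → ℕ → Past N → ℝ) (m : ℕ), 0 < m → ∀ z : Phase N,
    fullSum Φ τ r g h z = ∑ k ∈ Finset.range m, slotSum Φ τ r (wEnd τ m k) (wEnd τ m (k + 1)) g h z :=
  fun _ _ Φ _ hτ r g h _ hm z => fullSum_eq_sum_slotSum Φ hτ r g h hm z

end Summit.AtomisticToContinuum.HydrodynamicLimit.Theorems.KickFairRelEquilibriumMesoLine

end
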